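import Literature.NumberTheory.Automorphic.SmoothInduction
import Literature.NumberTheory.Automorphic.UnitaryGroupBorelInduction
import Literature.NumberTheory.Automorphic.UnitaryGroupPrincipalSeriesH
import Literature.NumberTheory.Automorphic.LocalUnitaryGroupCongr
import Literature.NumberTheory.Automorphic.LocalUnitaryGroupCongrInner
import Literature.NumberTheory.Automorphic.IrreducibleClassesComap
import Literature.NumberTheory.Automorphic.IrreducibleClassesConstituents
import Literature.NumberTheory.Automorphic.IrreducibleClassesBoxChar
import Literature.NumberTheory.Automorphic.JacquetNonzeroEmbedsNormalizedInd
import Summits.HodgeConjecture.HodgeConjecture.Theorems.R90S4SimilConjOfNormRatio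
import Summits.HodgeConjecture.HodgeConjecture.Theorems.R90S4FixedUnitsModNormsLeTwo
import Mathlib.RepresentationTheory.Intertwining
import HarnessLib

/-!
# R90 · S3 · hand p05 §T2-pre — «PS-SIMIL-TRANSPORT»: similitude conjugation preserves `JH(i(χ))` on `U(Φ₂)(L⁺_v)` (and on `H_v` after `⊠ χ₁`)

R90-TF SLAB (brief v2 1f40d54518340a35), section S3, dealer R90-C12-plan (g0); hand p05 RE-SCOPED by RULING S3-R3 «ORBIT HOMOGENEITY» (R90 bus
2026-09-04T15:50:18Z, 15:56:37Z); seat K2E1-p11 (g3); crux H413 = `stmt-HodgeConjecture-24833`, route `HCCMUnconditional`, lane `--supports … --as helper`.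
The ONE missing ★ lemma of the p05 census (`R90/S3/CENSUS-p05-homogeneity.K2E1-p11-g3.md`): T2∕T3∕T4 homogeneity of `H_v`-packets reduce to it.

THE MATHEMATICS ([Rogawski1990, §11.1 p. 161: «an L-packet on `U(2)` is a `PGL₂(F)`-orbit»; §12.1 p. 171, §12.2 p. 173: the principal series `i(χ)` of
`U(Φ₂)` and of `H = U(Φ₂) × U(Φ₁)`]; [BernsteinZelevinsky1977, §2.3]).  A local similitude `T` of `(Φ₂)_v` (`ᵗT̄ Φ₂ T = a Φ₂`, `a` a unit) acts on
`Irr(U(Φ₂)(L⁺_v))` by `c ↦ c ∘ Ad(T)` (★ `cmDatumLocalCongr`, ★ `IrrClass.comap`).  CLAIM: **`c ∘ Ad(T) ∈ JH(i(χ)) ↔ c ∈ JH(i(χ))` for every character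
`χ` of the diagonal torus** (`comap_simil_isConstituentOf_cmPrincipalSeries_iff`), and the same for the members `c ⊠ χ₁` of `H_v`-packets and
`i_H(χ₂ ⊠ χ₁)` (`boxChar_comap_simil_isConstituentOf_cmPrincipalSeriesH_iff`).  PROOF.  (i) The multiplier `a` is `σ`-fixed (★
`conjLocal_eq_self_of_formCongr_eq_smul_antidiag`) and `a = z̄ z · r` for a fixed unit `r` (★ `exists_fixed_units_mod_norms_card_le_two`), so `Ad(T)` pulls back
classes exactly as the DIAGONAL similitude `d_r = diag(r, 1)` does (★ `comap_cmDatumLocalCongr_eq_of_norm`).  (ii) `Ad(d_r)` stabilises the Borel `B`, fixes the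
diagonal torus `T` pointwise and stabilises `N` (§2; diagonal matrices commute, conjugating an upper-triangular matrix by diagonal ones keeps it upper
triangular with the same diagonal).  (iii) For ANY topological-group automorphism `e` of `U(Φ_N)(L⁺_v)` with these three properties, `f ↦ f ∘ e` is an
isomorphism `i(χ) ∘ e ≅ i(χ)` (§1 generic transport of ★ `smoothIndRep` along an automorphism stabilising `(H, σ)`; §3: on `b = t n`, `e b = t · e n` has the same
torus part and `δ_B^{1/2}(n) = δ_B^{1/2}(e n) = 1`, ★ `rootDeltaChar_eq_one_of_isLimitOfCompactOpen`, ★ `ParabolicTriple.proj_apply_of_mem_N`).  (iv) ★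
`comap_isConstituentOf_comp_iff` + ★ `isConstituentOf_congr`; (v) on `H_v`, ★ `cmPrincipalSeriesH = (i(χ₂) ∘ fst) ⊗ (χ₁ ∘ snd)` and ★ `boxChar_isConstituentOf_iff`.

§1 generic transport `nonempty_equiv_smoothIndRep_comp` · §2 the diagonal similitude and `Ad(d_u)` on `B ∕ T ∕ N` · §3 `nonempty_equiv_cmPrincipalSeries_comp`,
`comap_isConstituentOf_cmPrincipalSeries_iff` (every `N`) · §4 `comap_simil_isConstituentOf_cmPrincipalSeries_iff` (`N = 2`) · §5 the `H_v` form.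
HEARTBEATS (measured, R36): §3 `borelChar_eq_of_decomp` ∕ `nonempty_equiv_cmPrincipalSeries_comp` and §4–§5's two heads elaborate the product
`↥(cmBorelTriple L N v).P` ∕ the `cmDatum` vs `unitaryGroupOfForm` carrier spellings and time out at the default 200 000; `maxHeartbeats 800000` suffices
(no `synthInstance` bump).  ★-ONLY IMPORTS (Literature ∕ Theorems); no definition, no instance, no notation, no `sorry`.

HONEST LABEL: HC_CM is proved only modulo the 7 printed citations (2 remaining named inputs: hLiu418 = stmt-HodgeConjecture-24832, h413 = stmt-HodgeConjecture-24833)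
until rung 0 closes; this file is sorry-free local representation theory over ★ currency (no printed theorem of Ch. 13 is discharged by it); REL ≠ ★ ≠ BUILT.

## References
* [Rogawski1990] J. D. Rogawski, *Automorphic Representations of Unitary Groups in Three Variables*, Ann. of Math. Stud. 123 (1990): §1.10 p. 9 (`B = MN`),
  §11.1 p. 161 (packets of `U(2)` as `PGL₂(F)`-orbits), §12.1 pp. 171–172, §12.2 p. 173 (principal series of `H` and `G`).
* [BernsteinZelevinsky1977] I. N. Bernstein, A. V. Zelevinsky, Ann. Sci. ÉNS 10 (1977), §1.8, §2.3; [BernsteinZelevinsky1976] iid., Russian Math. Surveys 31 (1976), §2.21.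
* [BushnellHenniart2006] C. J. Bushnell, G. Henniart, *The Local Langlands Conjecture for GL(2)*, Grundlehren 335 (2006), §1.1, §2.4.
* [PlatonovRapinchuk1994] V. Platonov, A. Rapinchuk, *Algebraic Groups and Number Theory* (1994), §2.3 (similitudes).
-/

set_option autoImplicit false
-- the mandated namespace repeats the single-problem summit's segment (`HodgeConjecture.HodgeConjecture`)
set_option linter.dupNamespace false

noncomputable section

open NumberField IsDedekindDomain
open scoped Matrix MatrixGroups
open Literature.NumberTheory.Automorphic Literature.NumberTheory.Automorphic.UnitaryGroup

namespace Summit.HodgeConjecture.HodgeConjecture.R90.S3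

/-! ## §1 Generic: transport of smooth induction along an automorphism stabilising `(H, σ)` -/

section Transport

open Representation

variable {k : Type*} [CommRing k] {G : Type*} [Group G] [TopologicalSpace G] [IsTopologicalGroup G]
  {W : Type*} [AddCommGroup W] [Module k W] (H : Subgroup G) (σ : Representation k H W)

/-- Pull-back `f ∘ e` of an induced function along an automorphism `e` of `G` with `e(H) = H` and `σ ∘ e = σ` on `H` lies in the induced
space: `f (e (h g)) = f (e h · e g) = σ(e h) f(e g) = σ(h) f(e g)`. [cite: BernsteinZelevinsky1977, §1.8, §2.3] -/
theorem comp_mem_coindV (e : G ≃ₜ* G) (hH : ∀ g, e g ∈ H ↔ g ∈ H)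
    (hσ : ∀ h : H, σ ⟨e h, (hH h).2 h.2⟩ = σ h) (f : SmoothInd H σ) :
    (fun x => f.toFun (e x)) ∈ coindV H.subtype σ := by
  rw [mem_indFun_iff]
  intro h g
  show f.toFun (e ((h : G) * g)) = σ h (f.toFun (e g))
  rw [map_mul, ← hσ h]
  exact f.toFun_subgroup_mul ⟨e h, (hH h).2 h.2⟩ (e g)

/-- … and `f ∘ e` is a smooth vector for right translation: its stabiliser contains `e⁻¹(Stab f)`, open by continuity of `e`.
[cite: BernsteinZelevinsky1976, §2.21] -/
theorem isSmoothVector_comp (e : G ≃ₜ* G) (hH : ∀ g, e g ∈ H ↔ g ∈ H)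
    (hσ : ∀ h : H, σ ⟨e h, (hH h).2 h.2⟩ = σ h) (f : SmoothInd H σ) :
    (indFun H σ).IsSmoothVector ⟨fun x => f.toFun (e x), comp_mem_coindV H σ e hH hσ f⟩ := by
  have hf : (indFun H σ).IsSmoothVector (show ↥(smoothInd H σ).toSubmodule from f).1 :=
    (show ↥(smoothInd H σ).toSubmodule from f).2
  refine (indFun H σ).isSmoothVector_of_le
    (K := ((indFun H σ).stabilizerSubgroup (show ↥(smoothInd H σ).toSubmodule from f).1).comap (e : G →* G))
    (hf.preimage e.continuous) fun u hu => ?_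
  rw [Subgroup.mem_comap, mem_stabilizerSubgroup] at hu
  rw [mem_stabilizerSubgroup]
  apply Subtype.ext
  funext x
  show f.toFun (e (x * u)) = f.toFun (e x)
  have hux := congrArg (fun F : ↥(coindV H.subtype σ) => (F : G → W) (e x)) hu
  simp only [indFun_apply_apply] at hux
  rw [map_mul]
  exact hux

/-- **TRANSPORT OF SMOOTH INDUCTION along an automorphism `e` of `G` stabilising `H` and fixing `σ`**: `f ↦ f ∘ e` is an isomorphism of
representations `(Ind_H^G σ) ∘ e ≅ Ind_H^G σ` (right-translation model: `(f ∘ e)(x · g) = f(e x · e g)`; inverse `f ↦ f ∘ e⁻¹`).  «If `π` is a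
representation of `G` and `e` an automorphism, `π ∘ e` …»: for `π = i(χ)` and `e` preserving the inducing data, `π ∘ e ≅ π`.
[cite: BernsteinZelevinsky1977, §2.3] [cite: BushnellHenniart2006, §1.1, §2.4] -/
theorem nonempty_equiv_smoothIndRep_comp (e : G ≃ₜ* G) (hH : ∀ g, e g ∈ H ↔ g ∈ H)
    (hσ : ∀ h : H, σ ⟨e h, (hH h).2 h.2⟩ = σ h) :
    Nonempty (Representation.Equiv ((smoothIndRep H σ).comp (e : G →* G)) (smoothIndRep H σ)) := by
  -- the same hypotheses for `e⁻¹`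
  have hH' : ∀ g, e.symm g ∈ H ↔ g ∈ H := fun g => by
    rw [← hH (e.symm g), ContinuousMulEquiv.apply_symm_apply]
  have hσ' : ∀ h : H, σ ⟨e.symm h, (hH' h).2 h.2⟩ = σ h := fun h => by
    have h1 := hσ ⟨e.symm h, (hH' h).2 h.2⟩
    have h2 : (⟨e ((⟨e.symm h, (hH' h).2 h.2⟩ : H) : G), (hH _).2 ((hH' h).2 h.2)⟩ : H) = h :=
      Subtype.ext (ContinuousMulEquiv.apply_symm_apply e h)
    rw [h2] at h1
    exact h1.symm
  -- the two pull-backs as maps of `SmoothInd H σ`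
  let Φ : SmoothInd H σ → SmoothInd H σ := fun f =>
    (⟨⟨fun x => f.toFun (e x), comp_mem_coindV H σ e hH hσ f⟩, isSmoothVector_comp H σ e hH hσ f⟩ :
      ↥(smoothInd H σ).toSubmodule)
  let Ψ : SmoothInd H σ → SmoothInd H σ := fun f =>
    (⟨⟨fun x => f.toFun (e.symm x), comp_mem_coindV H σ e.symm hH' hσ' f⟩, isSmoothVector_comp H σ e.symm hH' hσ' f⟩ :
      ↥(smoothInd H σ).toSubmodule)
  have hΦ : ∀ f x, (Φ f).toFun x = f.toFun (e x) := fun _ _ => rfl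
  have hΨ : ∀ f x, (Ψ f).toFun x = f.toFun (e.symm x) := fun _ _ => rfl
  let E : SmoothInd H σ ≃ₗ[k] SmoothInd H σ :=
    { toFun := Φ
      map_add' := fun f g => SmoothInd.ext (funext fun x => by rw [hΦ, SmoothInd.toFun_add, SmoothInd.toFun_add]; rfl)
      map_smul' := fun c f => SmoothInd.ext (funext fun x => by rw [hΦ, SmoothInd.toFun_smul, SmoothInd.toFun_smul]; rfl)
      invFun := Ψ
      left_inv := fun f => SmoothInd.ext (funext fun x => by rw [hΨ, hΦ, ContinuousMulEquiv.apply_symm_apply])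
      right_inv := fun f => SmoothInd.ext (funext fun x => by rw [hΦ, hΨ, ContinuousMulEquiv.symm_apply_apply]) }
  refine ⟨Representation.Equiv.mk E fun g => LinearMap.ext fun f => SmoothInd.ext (funext fun x => ?_)⟩
  show (Φ (smoothIndRep H σ (e g) f)).toFun x = (smoothIndRep H σ g (Φ f)).toFun x
  rw [hΦ, toFun_smoothIndRep_apply, toFun_smoothIndRep_apply, hΦ, map_mul]

end Transport

/-! ## §2 The diagonal similitude `d_u = diag(u, 1)` of `(Φ₂)_v` and its action `Ad(d_u)` on the Borel data of `U(Φ₂)(L⁺_v)` -/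

/-- Conjugating a block-upper-triangular matrix by diagonal matrices keeps it block upper triangular. [cite: Rogawski1990, §1.10 p. 9] -/
theorem blockTriangular_diagonal_mul_mul_diagonal {R : Type*} [CommRing R] {n : ℕ} {M : Matrix (Fin n) (Fin n) R}
    (hM : M.BlockTriangular id) (d d' : Fin n → R) : (Matrix.diagonal d * M * Matrix.diagonal d').BlockTriangular id :=
  ((Matrix.blockTriangular_diagonal d).mul hM).mul (Matrix.blockTriangular_diagonal d')

section CM

variable (L : Type) [Field L] [NumberField L] [IsCMField L] (v : HeightOneSpectrum (𝓞 ↥(maximalRealSubfield L)))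

/-- **`d_u := diag(u, 1)` is a similitude of `(Φ₂)_v` with multiplier `u`** when `ū = u` (`u` a unit of `L ⊗ L⁺_v`): `ᵗ(diag(ū, 1)) · Φ₂ · diag(u, 1) = u • Φ₂`.
(Adapted from the private lemma of ★ `R90S4SimilOrbitCardLeTwo`, in ★ `glDiagonal` currency.) [cite: Rogawski1990, §11.1 p. 161] [cite: PlatonovRapinchuk1994, §2.3] -/
theorem formCongr_glDiagonal_two (u : (LocalRing L v)ˣ) (hu : conjLocal L (IsCMField.complexConj L) v u = u) :
    formCongr (conjLocal L (IsCMField.complexConj L) v) (glDiagonal 2 (LocalRing L v) ![u, 1])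
        ((Matrix.of fun i j : Fin 2 => if i.val + j.val + 1 = 2 then (1 : L) else 0).map (algebraMap L (LocalRing L v))) =
      (u : LocalRing L v) • (Matrix.of fun i j : Fin 2 => if i.val + j.val + 1 = 2 then (1 : L) else 0).map (algebraMap L (LocalRing L v)) := by
  have hmap : (fun k : Fin 2 => conjLocal L (IsCMField.complexConj L) v (((![u, 1] : Fin 2 → (LocalRing L v)ˣ) k : (LocalRing L v)ˣ) : LocalRing L v)) =
      fun k : Fin 2 => (((![u, 1] : Fin 2 → (LocalRing L v)ˣ) k : (LocalRing L v)ˣ) : LocalRing L v) := by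
    funext k
    fin_cases k
    · exact hu
    · simp
  rw [formCongr, coe_glDiagonal, Matrix.diagonal_map (map_zero _), hmap, Matrix.diagonal_transpose]
  ext i j
  rw [Matrix.mul_diagonal, Matrix.diagonal_mul, Matrix.smul_apply, Matrix.map_apply, Matrix.of_apply, smul_eq_mul]
  fin_cases i <;> fin_cases j <;> simp

/-- **`Ad(d_u)` FIXES THE DIAGONAL TORUS pointwise** (diagonal matrices commute). [cite: Rogawski1990, §1.10 p. 9] -/
theorem cmDatumLocalCongr_glDiagonal_apply_of_mem_torusU (u : (LocalRing L v)ˣ) (hu : conjLocal L (IsCMField.complexConj L) v u = u)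
    {t : (cmDatum L 2 (Matrix.of fun i j : Fin 2 => if i.val + j.val + 1 = 2 then (1 : L) else 0)).Local v}
    (ht : t ∈ torusU (conjLocal L (IsCMField.complexConj L) v) (cmLocalForm L 2 v)) :
    cmDatumLocalCongr L v (glDiagonal 2 (LocalRing L v) ![u, 1]) u.isUnit (formCongr_glDiagonal_two L v u hu) t = t := by
  obtain ⟨d, hd⟩ := (mem_torusU_iff t).1 ht
  apply Subtype.ext
  rw [coe_cmDatumLocalCongr_apply, ← hd, ← map_inv, ← map_mul, ← map_mul, mul_inv_cancel_comm]

/-- **`Ad(d_u)` STABILISES THE BOREL `B`** (upper-triangular matrices), in both directions. [cite: Rogawski1990, §1.10 p. 9] -/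
theorem cmDatumLocalCongr_glDiagonal_mem_borelU_iff (u : (LocalRing L v)ˣ) (hu : conjLocal L (IsCMField.complexConj L) v u = u)
    (g : (cmDatum L 2 (Matrix.of fun i j : Fin 2 => if i.val + j.val + 1 = 2 then (1 : L) else 0)).Local v) :
    cmDatumLocalCongr L v (glDiagonal 2 (LocalRing L v) ![u, 1]) u.isUnit (formCongr_glDiagonal_two L v u hu) g ∈
        borelU (conjLocal L (IsCMField.complexConj L) v) (cmLocalForm L 2 v) ↔
      g ∈ borelU (conjLocal L (IsCMField.complexConj L) v) (cmLocalForm L 2 v) := by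
  have hval : ((cmDatumLocalCongr L v (glDiagonal 2 (LocalRing L v) ![u, 1]) u.isUnit (formCongr_glDiagonal_two L v u hu) g).val :
      GL (Fin 2) (LocalRing L v)) = glDiagonal 2 (LocalRing L v) ![u, 1] * g.val * glDiagonal 2 (LocalRing L v) (![u, 1])⁻¹ := by
    rw [coe_cmDatumLocalCongr_apply, map_inv]
  constructor
  · intro h
    have h' := (mem_borelU_iff _).1 h
    rw [hval] at h'
    have hg : (g.val : GL (Fin 2) (LocalRing L v)) =
        glDiagonal 2 (LocalRing L v) (![u, 1])⁻¹ * (glDiagonal 2 (LocalRing L v) ![u, 1] * g.val * glDiagonal 2 (LocalRing L v) (![u, 1])⁻¹) *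
          glDiagonal 2 (LocalRing L v) ![u, 1] := by
      rw [map_inv]; group
    refine (mem_borelU_iff _).2 ?_
    rw [hg, Units.val_mul, Units.val_mul, coe_glDiagonal, coe_glDiagonal]
    exact blockTriangular_diagonal_mul_mul_diagonal h' _ _
  · intro h
    have h' := (mem_borelU_iff _).1 h
    refine (mem_borelU_iff _).2 ?_
    rw [hval, Units.val_mul, Units.val_mul, coe_glDiagonal, coe_glDiagonal]
    exact blockTriangular_diagonal_mul_mul_diagonal h' _ _

/-- **`Ad(d_u)` STABILISES THE UNIPOTENT RADICAL `N`** (upper unitriangular matrices): `diag(e) n diag(e)⁻¹` has the same (unit) diagonal.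
[cite: Rogawski1990, §1.10 p. 9] -/
theorem cmDatumLocalCongr_glDiagonal_mem_unipotentU (u : (LocalRing L v)ˣ) (hu : conjLocal L (IsCMField.complexConj L) v u = u)
    {n : (cmDatum L 2 (Matrix.of fun i j : Fin 2 => if i.val + j.val + 1 = 2 then (1 : L) else 0)).Local v}
    (hn : n ∈ unipotentU (conjLocal L (IsCMField.complexConj L) v) (cmLocalForm L 2 v)) :
    cmDatumLocalCongr L v (glDiagonal 2 (LocalRing L v) ![u, 1]) u.isUnit (formCongr_glDiagonal_two L v u hu) n ∈
      unipotentU (conjLocal L (IsCMField.complexConj L) v) (cmLocalForm L 2 v) := by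
  have hn' := (mem_unipotentU_iff _).1 hn
  have hval : ((cmDatumLocalCongr L v (glDiagonal 2 (LocalRing L v) ![u, 1]) u.isUnit (formCongr_glDiagonal_two L v u hu) n).val.val :
      Matrix (Fin 2) (Fin 2) (LocalRing L v)) =
      Matrix.diagonal (fun k => (((![u, 1] : Fin 2 → (LocalRing L v)ˣ) k : (LocalRing L v)ˣ) : LocalRing L v)) * n.val.val *
        Matrix.diagonal (fun k => (((![u, 1] : Fin 2 → (LocalRing L v)ˣ)⁻¹ k : (LocalRing L v)ˣ) : LocalRing L v)) := by
    rw [coe_cmDatumLocalCongr_apply, ← map_inv, Units.val_mul, Units.val_mul, coe_glDiagonal, coe_glDiagonal]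
  refine (mem_unipotentU_iff _).2 ⟨?_, fun i => ?_⟩
  · rw [hval]
    exact blockTriangular_diagonal_mul_mul_diagonal hn'.1 _ _
  · rw [hval, Matrix.mul_diagonal, Matrix.diagonal_mul, hn'.2 i, mul_one, Pi.inv_apply, Units.mul_inv]

/-! ## §3 An automorphism of `U(Φ_N)(L⁺_v)` stabilising `B`, fixing `T` pointwise and stabilising `N` preserves `i(χ)` up to isomorphism -/

set_option maxHeartbeats 800000 in
/-- **The inducing character `(χ ∘ proj) · δ_B^{1/2}` of `B = T ⋉ N` only sees the torus part**: if `q, q′ ∈ B` have decompositions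
`q = t₀ n`, `q′ = t₀ n′` with the SAME `t₀ ∈ T` and `n, n′ ∈ N`, the character agrees on them (`proj (t₀ n) = t₀` ★ `proj_apply_of_mem_M ∕ _N`;
`δ_B^{1/2}(n) = 1` ★ `rootDeltaChar_eq_one_of_isLimitOfCompactOpen`). [cite: BernsteinZelevinsky1977, §1.8, §2.3] [cite: Rogawski1990, §12.1 p. 171] -/
theorem borelChar_eq_of_decomp (N : ℕ)
    (χ : ↥(torusU (conjLocal L (IsCMField.complexConj L) v) (cmLocalForm L N v)) →* ℂˣ)
    (q q' : ↥(cmBorelTriple L N v).P)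
    {t₀ n n' : ↥(unitaryGroupOfForm (conjLocal L (IsCMField.complexConj L) v) (cmLocalForm L N v))}
    (ht₀ : t₀ ∈ (cmBorelTriple L N v).M) (hn : n ∈ (cmBorelTriple L N v).N) (hn' : n' ∈ (cmBorelTriple L N v).N)
    (hq : (q : ↥(unitaryGroupOfForm (conjLocal L (IsCMField.complexConj L) v) (cmLocalForm L N v))) = t₀ * n)
    (hq' : (q' : ↥(unitaryGroupOfForm (conjLocal L (IsCMField.complexConj L) v) (cmLocalForm L N v))) = t₀ * n') :
    (haveI := locallyCompactSpace_cmBorelU L N v;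
      Representation.twist
        (((Representation.trivial ℂ ↥(torusU (conjLocal L (IsCMField.complexConj L) v) (cmLocalForm L N v)) ℂ).twist χ).comp
          (cmBorelTriple L N v).proj)
        (rootDeltaChar (cmBorelTriple L N v).P) q) =
    (haveI := locallyCompactSpace_cmBorelU L N v;
      Representation.twist
        (((Representation.trivial ℂ ↥(torusU (conjLocal L (IsCMField.complexConj L) v) (cmLocalForm L N v)) ℂ).twist χ).comp
          (cmBorelTriple L N v).proj)
        (rootDeltaChar (cmBorelTriple L N v).P) q') := by
  haveI := locallyCompactSpace_cmBorelU L N v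
  -- the two factorizations inside `↥P`
  have hqP : q = ⟨t₀, (cmBorelTriple L N v).M_le ht₀⟩ * ⟨n, (cmBorelTriple L N v).N_le hn⟩ := Subtype.ext hq
  have hq'P : q' = ⟨t₀, (cmBorelTriple L N v).M_le ht₀⟩ * ⟨n', (cmBorelTriple L N v).N_le hn'⟩ := Subtype.ext hq'
  have hproj : (cmBorelTriple L N v).proj q = (cmBorelTriple L N v).proj q' := by
    have h1 : (cmBorelTriple L N v).proj q = (cmBorelTriple L N v).proj ⟨t₀, (cmBorelTriple L N v).M_le ht₀⟩ := by
      rw [hqP, map_mul, (cmBorelTriple L N v).proj_apply_of_mem_N ⟨n, (cmBorelTriple L N v).N_le hn⟩ hn, mul_one]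
    have h2 : (cmBorelTriple L N v).proj q' = (cmBorelTriple L N v).proj ⟨t₀, (cmBorelTriple L N v).M_le ht₀⟩ := by
      rw [hq'P, map_mul, (cmBorelTriple L N v).proj_apply_of_mem_N ⟨n', (cmBorelTriple L N v).N_le hn'⟩ hn', mul_one]
    rw [h1, h2]
  have hδ : rootDeltaChar (cmBorelTriple L N v).P q = rootDeltaChar (cmBorelTriple L N v).P q' := by
    have h1 : rootDeltaChar (cmBorelTriple L N v).P q = rootDeltaChar (cmBorelTriple L N v).P ⟨t₀, (cmBorelTriple L N v).M_le ht₀⟩ := by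
      rw [hqP, map_mul, (cmBorelTriple L N v).rootDeltaChar_eq_one_of_isLimitOfCompactOpen (isLimitOfCompactOpen_cmBorelTriple_N L N v) n hn,
        mul_one]
    have h2 : rootDeltaChar (cmBorelTriple L N v).P q' = rootDeltaChar (cmBorelTriple L N v).P ⟨t₀, (cmBorelTriple L N v).M_le ht₀⟩ := by
      rw [hq'P, map_mul, (cmBorelTriple L N v).rootDeltaChar_eq_one_of_isLimitOfCompactOpen (isLimitOfCompactOpen_cmBorelTriple_N L N v) n' hn',
        mul_one]
    rw [h1, h2]
  refine LinearMap.ext fun z => ?_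
  rw [Representation.twist_apply, Representation.twist_apply, MonoidHom.comp_apply, MonoidHom.comp_apply, hproj, hδ]

set_option maxHeartbeats 800000 in
/-- **TRANSPORT OF THE PRINCIPAL SERIES**: for a topological-group automorphism `e` of `U(Φ_N)(L⁺_v)` that stabilises the Borel `B` (`hB`), fixes the
diagonal torus `T` pointwise (`hT`) and stabilises the unipotent radical `N` (`hN`), `i(χ) ∘ e ≅ i(χ)` for EVERY character `χ` of `T`
(§1 with `H = B`, `σ = (χ ∘ proj)·δ_B^{1/2}`: on `b = t n`, `e b = t · e n` has the same torus part). [cite: BernsteinZelevinsky1977, §2.3]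
[cite: Rogawski1990, §12.1 p. 171; §12.2 p. 173] -/
theorem nonempty_equiv_cmPrincipalSeries_comp (N : ℕ)
    (e : ↥(unitaryGroupOfForm (conjLocal L (IsCMField.complexConj L) v) (cmLocalForm L N v)) ≃ₜ*
      ↥(unitaryGroupOfForm (conjLocal L (IsCMField.complexConj L) v) (cmLocalForm L N v)))
    (hB : ∀ g, e g ∈ (cmBorelTriple L N v).P ↔ g ∈ (cmBorelTriple L N v).P)
    (hT : ∀ t ∈ (cmBorelTriple L N v).M, e t = t)
    (hN : ∀ n ∈ (cmBorelTriple L N v).N, e n ∈ (cmBorelTriple L N v).N)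
    (χ : ↥(torusU (conjLocal L (IsCMField.complexConj L) v) (cmLocalForm L N v)) →* ℂˣ) :
    Nonempty (Representation.Equiv
      ((cmPrincipalSeries L N v χ).comp
        (e : ↥(unitaryGroupOfForm (conjLocal L (IsCMField.complexConj L) v) (cmLocalForm L N v)) →*
          ↥(unitaryGroupOfForm (conjLocal L (IsCMField.complexConj L) v) (cmLocalForm L N v))))
      (cmPrincipalSeries L N v χ)) := by
  haveI := locallyCompactSpace_cmBorelU L N v
  suffices key : Nonempty (Representation.Equiv
      ((Representation.smoothIndRep (cmBorelTriple L N v).P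
        (Representation.twist
          (((Representation.trivial ℂ ↥(torusU (conjLocal L (IsCMField.complexConj L) v) (cmLocalForm L N v)) ℂ).twist χ).comp
            (cmBorelTriple L N v).proj)
          (rootDeltaChar (cmBorelTriple L N v).P))).comp
        (e : ↥(unitaryGroupOfForm (conjLocal L (IsCMField.complexConj L) v) (cmLocalForm L N v)) →*
          ↥(unitaryGroupOfForm (conjLocal L (IsCMField.complexConj L) v) (cmLocalForm L N v))))
      (Representation.smoothIndRep (cmBorelTriple L N v).P
        (Representation.twist
          (((Representation.trivial ℂ ↥(torusU (conjLocal L (IsCMField.complexConj L) v) (cmLocalForm L N v)) ℂ).twist χ).comp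
            (cmBorelTriple L N v).proj)
          (rootDeltaChar (cmBorelTriple L N v).P)))) by
    exact key
  refine nonempty_equiv_smoothIndRep_comp (cmBorelTriple L N v).P _ e hB fun p => ?_
  -- `p = t₀ n` with `t₀ = proj p ∈ T`, `n ∈ N`; then `e p = t₀ · e n`
  have hn : ((cmBorelTriple L N v).proj p : ↥(unitaryGroupOfForm (conjLocal L (IsCMField.complexConj L) v) (cmLocalForm L N v)))⁻¹ * p ∈
      (cmBorelTriple L N v).N := (cmBorelTriple L N v).proj_inv_mul_mem p
  refine borelChar_eq_of_decomp L v N χ _ p ((cmBorelTriple L N v).proj p).2 (hN _ hn) hn ?_ ?_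
  · have hp : (p : ↥(unitaryGroupOfForm (conjLocal L (IsCMField.complexConj L) v) (cmLocalForm L N v))) =
        ((cmBorelTriple L N v).proj p : ↥(unitaryGroupOfForm (conjLocal L (IsCMField.complexConj L) v) (cmLocalForm L N v))) *
          ((((cmBorelTriple L N v).proj p : ↥(unitaryGroupOfForm (conjLocal L (IsCMField.complexConj L) v) (cmLocalForm L N v))))⁻¹ *
            (p : ↥(unitaryGroupOfForm (conjLocal L (IsCMField.complexConj L) v) (cmLocalForm L N v)))) :=
      (mul_inv_cancel_left _ _).symm
    show e p = _
    conv_lhs => rw [hp]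
    rw [map_mul, hT _ ((cmBorelTriple L N v).proj p).2]
  · exact (mul_inv_cancel_left _ _).symm

set_option maxHeartbeats 400000 in
/-- **`JH(i(χ)) ∘ e = JH(i(χ))`**: under the hypotheses of `nonempty_equiv_cmPrincipalSeries_comp`, a class `c` of `U(Φ_N)(L⁺_v)` is a constituent of
`i(χ)` iff `c ∘ e` is (★ `comap_isConstituentOf_comp_iff` + ★ `isConstituentOf_congr`). [cite: Rogawski1990, §12.2 p. 173] [cite: BernsteinZelevinsky1977, §2.3] -/
theorem comap_isConstituentOf_cmPrincipalSeries_iff (N : ℕ)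
    (e : ↥(unitaryGroupOfForm (conjLocal L (IsCMField.complexConj L) v) (cmLocalForm L N v)) ≃ₜ*
      ↥(unitaryGroupOfForm (conjLocal L (IsCMField.complexConj L) v) (cmLocalForm L N v)))
    (hB : ∀ g, e g ∈ (cmBorelTriple L N v).P ↔ g ∈ (cmBorelTriple L N v).P)
    (hT : ∀ t ∈ (cmBorelTriple L N v).M, e t = t)
    (hN : ∀ n ∈ (cmBorelTriple L N v).N, e n ∈ (cmBorelTriple L N v).N)
    (χ : ↥(torusU (conjLocal L (IsCMField.complexConj L) v) (cmLocalForm L N v)) →* ℂˣ)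
    (c : IrrClass ↥(unitaryGroupOfForm (conjLocal L (IsCMField.complexConj L) v) (cmLocalForm L N v))) :
    (IrrClass.comap e c).IsConstituentOf (cmPrincipalSeries L N v χ) ↔ c.IsConstituentOf (cmPrincipalSeries L N v χ) := by
  obtain ⟨E⟩ := nonempty_equiv_cmPrincipalSeries_comp L v N e hB hT hN χ
  rw [← IrrClass.isConstituentOf_congr E (IrrClass.comap e c)]
  exact IrrClass.comap_isConstituentOf_comp_iff e _ c


/-! ## §4 Similitude conjugation `Ad(T)` (`ᵗT̄ Φ₂ T = a Φ₂`) preserves the constituents of every principal series `i(χ)` of `U(Φ₂)(L⁺_v)` -/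

/-- **For the diagonal similitude `d_u`**: `c ∘ Ad(d_u)` is a constituent of `i(χ)` iff `c` is (§3 at `e = Ad(d_u)`, which stabilises `B`, fixes `T` pointwise and
stabilises `N`, §2). [cite: Rogawski1990, §11.1 p. 161; §12.2 p. 173] -/
theorem comap_glDiagonal_isConstituentOf_cmPrincipalSeries_iff (u : (LocalRing L v)ˣ) (hu : conjLocal L (IsCMField.complexConj L) v u = u)
    (χ : ↥(torusU (conjLocal L (IsCMField.complexConj L) v) (cmLocalForm L 2 v)) →* ℂˣ)
    (c : IrrClass ((cmDatum L 2 (Matrix.of fun i j : Fin 2 => if i.val + j.val + 1 = 2 then (1 : L) else 0)).Local v)) :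
    (IrrClass.comap (cmDatumLocalCongr L v (glDiagonal 2 (LocalRing L v) ![u, 1]) u.isUnit (formCongr_glDiagonal_two L v u hu)) c).IsConstituentOf
        (cmPrincipalSeries L 2 v χ) ↔
      c.IsConstituentOf (cmPrincipalSeries L 2 v χ) :=
  comap_isConstituentOf_cmPrincipalSeries_iff L v 2 (cmDatumLocalCongr L v (glDiagonal 2 (LocalRing L v) ![u, 1]) u.isUnit (formCongr_glDiagonal_two L v u hu))
    (cmDatumLocalCongr_glDiagonal_mem_borelU_iff L v u hu) (fun _ ht => cmDatumLocalCongr_glDiagonal_apply_of_mem_torusU L v u hu ht)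
    (fun _ hn => cmDatumLocalCongr_glDiagonal_mem_unipotentU L v u hu hn) χ c

set_option maxHeartbeats 800000 in
/-- **SIMILITUDE CONJUGATION PRESERVES `JH(i(χ))`**: for EVERY local similitude `T` of `(Φ₂)_v` (`ᵗT̄ Φ₂ T = a Φ₂`, `a` a unit) and every character `χ` of the
diagonal torus, `c ∘ Ad(T)` is a constituent of the principal series `i(χ)` of `U(Φ₂)(L⁺_v)` iff `c` is.  The multiplier `a` is `σ`-fixed (★
`conjLocal_eq_self_of_formCongr_eq_smul_antidiag`), `a = z̄ z · r` for one of `≤ 2` fixed units `r` (★ `exists_fixed_units_mod_norms_card_le_two`), and `Ad(T)` pulls back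
classes exactly as `Ad(d_r)` does (★ `comap_cmDatumLocalCongr_eq_of_norm`); conclude by the diagonal case.  «An L-packet on `U(2)` is a `PGL₂(F)`-orbit»: the orbit
of a constituent of `i(χ)` stays inside `JH(i(χ))`. [cite: Rogawski1990, §11.1 p. 161; §12.2 p. 173] [cite: PlatonovRapinchuk1994, §2.3] -/
theorem comap_simil_isConstituentOf_cmPrincipalSeries_iff (T : GL (Fin 2) (LocalRing L v)) {a : LocalRing L v} (ha : IsUnit a)
    (h : formCongr (conjLocal L (IsCMField.complexConj L) v) T
        ((Matrix.of fun i j : Fin 2 => if i.val + j.val + 1 = 2 then (1 : L) else 0).map (algebraMap L (LocalRing L v))) =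
      a • (Matrix.of fun i j : Fin 2 => if i.val + j.val + 1 = 2 then (1 : L) else 0).map (algebraMap L (LocalRing L v)))
    (χ : ↥(torusU (conjLocal L (IsCMField.complexConj L) v) (cmLocalForm L 2 v)) →* ℂˣ)
    (c : IrrClass ((cmDatum L 2 (Matrix.of fun i j : Fin 2 => if i.val + j.val + 1 = 2 then (1 : L) else 0)).Local v)) :
    (IrrClass.comap (cmDatumLocalCongr L v T ha h) c).IsConstituentOf (cmPrincipalSeries L 2 v χ) ↔ c.IsConstituentOf (cmPrincipalSeries L 2 v χ) := by
  have haσ : conjLocal L (IsCMField.complexConj L) v a = a :=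
    conjLocal_eq_self_of_formCongr_eq_smul_antidiag L (N := 2) two_ne_zero (antidiagOne_isHermitian L 2) v T h
  obtain ⟨R, -, hR, hrep⟩ := Summit.HodgeConjecture.HodgeConjecture.R90.S4.exists_fixed_units_mod_norms_card_le_two L v
  obtain ⟨r, hr, z, hz⟩ := hrep a ha haσ
  have hru : conjLocal L (IsCMField.complexConj L) v ((hR r hr).1.unit : (LocalRing L v)ˣ) = (hR r hr).1.unit := by
    rw [IsUnit.unit_spec]; exact (hR r hr).2
  have hz' : a = conjLocal L (IsCMField.complexConj L) v z * z * ((hR r hr).1.unit : (LocalRing L v)ˣ) := by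
    rw [IsUnit.unit_spec]; exact hz
  rw [Summit.HodgeConjecture.HodgeConjecture.R90.S4.comap_cmDatumLocalCongr_eq_of_norm L v (glDiagonal 2 (LocalRing L v) ![(hR r hr).1.unit, 1]) T
    ((hR r hr).1.unit).isUnit ha (formCongr_glDiagonal_two L v _ hru) h z hz' c]
  exact comap_glDiagonal_isConstituentOf_cmPrincipalSeries_iff L v _ hru χ c

/-! ## §5 The same on `H_v = U(Φ₂)(L⁺_v) × U(Φ₁)(L⁺_v)` for `i_H(χ₂ ⊠ χ₁)` and the members `c ⊠ χ₁` -/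

set_option maxHeartbeats 800000 in
/-- **`(c ∘ Ad(T)) ⊠ χ₁ ∈ JH(i_H(χ₂ ⊠ χ₁)) ↔ c ⊠ χ₁ ∈ JH(i_H(χ₂ ⊠ χ₁))`** — the `H_v`-packet currency of S4-B (`ρ = O ⊠ χ₁`, `O` a similitude orbit): ★
`cmPrincipalSeriesH L v χ₂ χ₁ = i(χ₂) ∘ fst ⊗ χ₁ ∘ snd` (definitional), ★ `IrrClass.boxChar_isConstituentOf_iff`, §4.
[cite: Rogawski1990, §12.1 pp. 171–172; §11.1 p. 161] -/
theorem boxChar_comap_simil_isConstituentOf_cmPrincipalSeriesH_iff (T : GL (Fin 2) (LocalRing L v)) {a : LocalRing L v} (ha : IsUnit a)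
    (h : formCongr (conjLocal L (IsCMField.complexConj L) v) T
        ((Matrix.of fun i j : Fin 2 => if i.val + j.val + 1 = 2 then (1 : L) else 0).map (algebraMap L (LocalRing L v))) =
      a • (Matrix.of fun i j : Fin 2 => if i.val + j.val + 1 = 2 then (1 : L) else 0).map (algebraMap L (LocalRing L v)))
    (χ₂ : ↥(torusU (conjLocal L (IsCMField.complexConj L) v) (cmLocalForm L 2 v)) →* ℂˣ)
    (χ₁ : (cmDatum L 1 (Matrix.of fun i j : Fin 1 => if i.val + j.val + 1 = 1 then (1 : L) else 0)).Local v →* ℂˣ)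
    (hχ₁ : IsOpen ((χ₁.ker : Subgroup ((cmDatum L 1 (Matrix.of fun i j : Fin 1 => if i.val + j.val + 1 = 1 then (1 : L) else 0)).Local v)) :
      Set ((cmDatum L 1 (Matrix.of fun i j : Fin 1 => if i.val + j.val + 1 = 1 then (1 : L) else 0)).Local v)))
    (c : IrrClass ((cmDatum L 2 (Matrix.of fun i j : Fin 2 => if i.val + j.val + 1 = 2 then (1 : L) else 0)).Local v)) :
    (IrrClass.boxChar χ₁ hχ₁ (IrrClass.comap (cmDatumLocalCongr L v T ha h) c)).IsConstituentOf (cmPrincipalSeriesH L v χ₂ χ₁) ↔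
      (IrrClass.boxChar χ₁ hχ₁ c).IsConstituentOf (cmPrincipalSeriesH L v χ₂ χ₁) := by
  -- `i_H(χ₂ ⊠ χ₁) = (i(χ₂) ∘ fst) ⊗ (χ₁ ∘ snd)` definitionally; ★ constituent transport along `⊠ χ₁`
  have hbox : ∀ c' : IrrClass ((cmDatum L 2 (Matrix.of fun i j : Fin 2 => if i.val + j.val + 1 = 2 then (1 : L) else 0)).Local v),
      (IrrClass.boxChar χ₁ hχ₁ c').IsConstituentOf (cmPrincipalSeriesH L v χ₂ χ₁) ↔ c'.IsConstituentOf (cmPrincipalSeries L 2 v χ₂) :=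
    fun c' => IrrClass.boxChar_isConstituentOf_iff χ₁ hχ₁ _ c'
  rw [hbox, hbox]
  exact comap_simil_isConstituentOf_cmPrincipalSeries_iff L v T ha h χ₂ c


end CM

end Summit.HodgeConjecture.HodgeConjecture.R90.S3

end
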